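import Summits.BirchSwinnertonDyer.BirchSwinnertonDyer.Theorems.KolyvaginRankRigidityAtTwoPhantomMatrixCocycles
import Summits.BirchSwinnertonDyer.BirchSwinnertonDyer.Theorems.KolyvaginRankRigidityAtTwoPhantomFiniteSteps
import Mathlib.RingTheory.Nilpotent.Basic
import HarnessLib

/-!
# K1⁺ brick 4 — the congruence filtration: a normalised cocycle kills `Γ(4)` (step (3) of `|H¹(GL₂(ℤ/2^m), (ℤ/2^j)²)| ≤ 2`)

Crux U1 `KolyvaginBoundedDefectAtTwo` (stmt-BirchSwinnertonDyer-28083), LINE 17, support statement K1⁺ `PhantomLineAtTwo` (pen bsd-idea-1 g13;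
memo HOME `line17/K1_row_memo_g13.md` § v3, step (3)). Width seat `bsd-line-krr2-p2` g17; `--supports … --as helper`. PURE ALGEBRA, sequel of
`…PhantomMatrixCocycles` (same setting: `ρ : Γ → M₂(ℤ/2^m)` multiplicative, `ψ` a vector cocycle vanishing on `ker ρ`; here in addition
`ψ` is `2`-torsion-valued — the step-(1) normal form — and EVERY invertible matrix is in the image of `ρ` (`hsurj`)).

* §5 `vanishes_of_level_ge_three` — **(3)(a)** `ψ γ = 0` whenever `ρ γ = 1 + 2^i Y`, `i ≥ 3`: descending induction from `2^m = 0` with the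
  square roots `(1 + 2^(i−1) Y)² ≡ 1 + 2^i Y (mod 2^(i+1))` and transport along congruences (`mcocycle_eq_of_congr`);
* §6 `vanishes_of_level_two_of_trace_even` — trace-even `1 + 4X` are products of two squares `(1+2Y)²(1+2Y')²` modulo `8` (Cayley–Hamilton
  over `𝔽₂`: the pen's `PhantomFinite.traceZero_sum_of_two_square_values`); `mcocycle_eq_of_trace` — trace-parity transport; and
  **`vanishes_of_level_two`** — **(3)(b)** `ψ` kills all of `Γ(4)`: reduce to `θ_k` (`ρ θ_k = 1 + 4k E₁₁`), whose value is fixed by `S` and `U`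
  (compare `sθs⁻¹`, `tθt⁻¹` with `θ` by trace parity), hence `0`.
Nothing here proves K1⁺, S2, U1 or BSD. [cite: LawsonWuthrich2016, §7.1 and Thm. 1] [cite: Sah1968, Prop. 2.7 (b)]
-/

set_option autoImplicit false
-- the Theorems namespace of this sub repeats the summit name by design (D-0017 nested layout)
set_option linter.dupNamespace false

namespace Summit.BirchSwinnertonDyer.BirchSwinnertonDyer.Theorems.KolyvaginAtTwo.PhantomMatrix

open Matrix

variable {Γ : Type*} [Group Γ] {m : ℕ}

/-! ### §5 The congruence filtration: a normalised cocycle kills `Γ(4)` (step (3)) -/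

section Filtration

variable {ρ : Γ → Matrix (Fin 2) (Fin 2) (ZMod (2 ^ m))} {ψ : Γ → Fin 2 → ZMod (2 ^ m)}

/-- `1 + 2•Y` is invertible over `ℤ/2^m` (`2•Y` is nilpotent). [folklore] -/
theorem isUnit_one_add_two_smul (Y : Matrix (Fin 2) (Fin 2) (ZMod (2 ^ m))) :
    IsUnit (1 + (2 : ZMod (2 ^ m)) • Y) := by
  refine IsNilpotent.isUnit_one_add ⟨m, ?_⟩
  have h2m : (2 : ZMod (2 ^ m)) ^ m = 0 := by
    have := ZMod.natCast_self (2 ^ m); push_cast at this; exact this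
  rw [smul_pow, h2m, zero_smul]

/-- `1 + (2a)•Y` is invertible over `ℤ/2^m`. [folklore] -/
theorem isUnit_one_add_two_mul_smul (a : ZMod (2 ^ m)) (Y : Matrix (Fin 2) (Fin 2) (ZMod (2 ^ m))) :
    IsUnit (1 + (2 * a) • Y) := by
  rw [mul_smul]; exact isUnit_one_add_two_smul _

/-- Squaring inside the filtration: `(1 + a•Y)² = 1 + (2a)•Y + a²•Y²`. [folklore] -/
theorem one_add_smul_mul_self (a : ZMod (2 ^ m)) (Y : Matrix (Fin 2) (Fin 2) (ZMod (2 ^ m))) :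
    (1 + a • Y) * (1 + a • Y) = 1 + (2 * a) • Y + (a * a) • (Y * Y) := by
  simp only [add_mul, mul_add, one_mul, mul_one, smul_mul, Matrix.mul_smul, smul_smul, two_mul, add_smul]
  abel

/-- On `Γ(2)` a `2`-torsion-valued cocycle is ADDITIVE: `ψ (a b) = ψ a + ψ b` when `ρ a = 1 + 2•A`. [folklore] -/
theorem mcocycle_mul_of_mod_two (hψ : ∀ g h, ψ (g * h) = ψ g + ρ g *ᵥ ψ h) (h2 : ∀ g, (2 : ZMod (2 ^ m)) • ψ g = 0)
    {a : Γ} {A : Matrix (Fin 2) (Fin 2) (ZMod (2 ^ m))} (ha : ρ a = 1 + (2 : ZMod (2 ^ m)) • A) (b : Γ) :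
    ψ (a * b) = ψ a + ψ b := by
  rw [hψ, ha, add_mulVec, one_mulVec, smul_mulVec, ← mulVec_smul, h2, mulVec_zero, add_zero]

/-- A matrix of the shape `1 + 2•A` fixes `2`-torsion vectors. [folklore] -/
theorem mulVec_eq_self_of_mod_two {M A : Matrix (Fin 2) (Fin 2) (ZMod (2 ^ m))} (hM : M = 1 + (2 : ZMod (2 ^ m)) • A)
    {v : Fin 2 → ZMod (2 ^ m)} (hv : (2 : ZMod (2 ^ m)) • v = 0) : M *ᵥ v = v := by
  rw [hM, add_mulVec, one_mulVec, smul_mulVec, ← mulVec_smul, hv, mulVec_zero, add_zero]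

/-- **Transport along a congruence.** If `ψ` kills every `η` with `ρ η = 1 + c•Z`, then `ρ g = ρ g' + c•C` forces `ψ g = ψ g'`
(`ρ (g'⁻¹ g) = 1 + c•(ρ g'⁻¹ C)`). [folklore] -/
theorem mcocycle_eq_of_congr (hρ : ∀ g h, ρ (g * h) = ρ g * ρ h) (hρ1 : ρ 1 = 1)
    (hψ : ∀ g h, ψ (g * h) = ψ g + ρ g *ᵥ ψ h) {c : ZMod (2 ^ m)}
    (hQ : ∀ (η : Γ) (Z : Matrix (Fin 2) (Fin 2) (ZMod (2 ^ m))), ρ η = 1 + c • Z → ψ η = 0)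
    {g g' : Γ} (C : Matrix (Fin 2) (Fin 2) (ZMod (2 ^ m))) (h : ρ g = ρ g' + c • C) : ψ g = ψ g' := by
  have hη : ρ (g'⁻¹ * g) = 1 + c • (ρ g'⁻¹ * C) := by
    rw [hρ, h, mul_add, rho_inv_mul hρ hρ1, Matrix.mul_smul]
  have : g = g' * (g'⁻¹ * g) := by group
  rw [this, hψ, hQ _ _ hη, mulVec_zero, add_zero]

/-- The square of an element of `Γ(2)` is killed by a `2`-torsion-valued cocycle: `ψ (δδ) = 2ψδ + (2a)•(Y ψ δ) = 0`. [folklore] -/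
theorem mcocycle_sq_eq_zero (hψ : ∀ g h, ψ (g * h) = ψ g + ρ g *ᵥ ψ h) (h2 : ∀ g, (2 : ZMod (2 ^ m)) • ψ g = 0)
    {δ : Γ} {a : ZMod (2 ^ m)} {Y : Matrix (Fin 2) (Fin 2) (ZMod (2 ^ m))} (hδ : ρ δ = 1 + (2 * a) • Y) :
    ψ (δ * δ) = 0 := by
  rw [hψ, hδ, add_mulVec, one_mulVec, smul_mulVec, mul_comm, mul_smul, ← mulVec_smul, h2, mulVec_zero, smul_zero,
    add_zero, ← two_smul (ZMod (2 ^ m)), h2]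

/-- **Quotients inside the filtration** (no inverse matrix needed): if `ρ a = 1 + c•A` and `ρ b = 1 + c•B` then
`ρ (a⁻¹ b) = 1 + c•(B − A ρ(a⁻¹ b))`. [folklore] -/
theorem rho_inv_mul_eq (hρ : ∀ g h, ρ (g * h) = ρ g * ρ h) {a b : Γ} {c : ZMod (2 ^ m)}
    {A B : Matrix (Fin 2) (Fin 2) (ZMod (2 ^ m))} (ha : ρ a = 1 + c • A) (hb : ρ b = 1 + c • B) :
    ρ (a⁻¹ * b) = 1 + c • (B - A * ρ (a⁻¹ * b)) := by
  have h : ρ a * ρ (a⁻¹ * b) = ρ b := by rw [← hρ, mul_inv_cancel_left]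
  rw [ha, add_mul, one_mul, smul_mul, hb] at h
  calc ρ (a⁻¹ * b) = (ρ (a⁻¹ * b) + c • (A * ρ (a⁻¹ * b))) - c • (A * ρ (a⁻¹ * b)) := by abel
    _ = 1 + c • (B - A * ρ (a⁻¹ * b)) := by rw [h, smul_sub]; abel

/-- **Step (3)(a): `Γ(8)` is killed.** For a `2`-torsion-valued cocycle vanishing on `ker ρ`, with every unit in the image of `ρ`:
`ψ γ = 0` whenever `ρ γ = 1 + 2^i•Y` with `i ≥ 3` — descending induction from the top level `2^m = 0`, using
`(1 + 2^(i−1) Y)² = 1 + 2^i Y + 2^(i+1)·(2^(i−3) Y²)`. [cite: LawsonWuthrich2016, §7.1] -/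
theorem vanishes_of_level_ge_three (hρ : ∀ g h, ρ (g * h) = ρ g * ρ h) (hρ1 : ρ 1 = 1)
    (hsurj : ∀ M : Matrix (Fin 2) (Fin 2) (ZMod (2 ^ m)), IsUnit M → ∃ γ, ρ γ = M)
    (hψ : ∀ g h, ψ (g * h) = ψ g + ρ g *ᵥ ψ h) (hN : ∀ n, ρ n = 1 → ψ n = 0)
    (h2 : ∀ g, (2 : ZMod (2 ^ m)) • ψ g = 0) :
    ∀ (i : ℕ), 3 ≤ i → ∀ (γ : Γ) (Y : Matrix (Fin 2) (Fin 2) (ZMod (2 ^ m))),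
      ρ γ = 1 + (2 : ZMod (2 ^ m)) ^ i • Y → ψ γ = 0 := by
  suffices key : ∀ (n i : ℕ), 3 ≤ i → m ≤ i + n → ∀ (γ : Γ) (Y : Matrix (Fin 2) (Fin 2) (ZMod (2 ^ m))),
      ρ γ = 1 + (2 : ZMod (2 ^ m)) ^ i • Y → ψ γ = 0 from
    fun i hi γ Y h ↦ key m i hi (by omega) γ Y h
  have htop : ∀ i, m ≤ i → ∀ (γ : Γ) (Y : Matrix (Fin 2) (Fin 2) (ZMod (2 ^ m))),
      ρ γ = 1 + (2 : ZMod (2 ^ m)) ^ i • Y → ψ γ = 0 := by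
    intro i hi γ Y h
    have h0 : (2 : ZMod (2 ^ m)) ^ i = 0 := by
      obtain ⟨d, rfl⟩ : ∃ d, i = m + d := ⟨i - m, by omega⟩
      have h2m : (2 : ZMod (2 ^ m)) ^ m = 0 := by
        have := ZMod.natCast_self (2 ^ m); push_cast at this; exact this
      rw [pow_add, h2m, zero_mul]
    rw [h0, zero_smul, add_zero] at h
    exact hN γ h
  intro n
  induction n with
  | zero => exact fun i _ hm ↦ htop i (by omega)
  | succ n ih =>
    intro i hi hm γ Y hγ
    by_cases him : m ≤ i
    · exact htop i him γ Y hγ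
    -- a square root `δ` of `γ` modulo `2^(i+1)`
    have e1 : (2 : ZMod (2 ^ m)) ^ (i - 1) = 2 * 2 ^ (i - 2) := by
      rw [← pow_succ']; congr 1; omega
    obtain ⟨δ, hδ⟩ := hsurj (1 + (2 : ZMod (2 ^ m)) ^ (i - 1) • Y) (by rw [e1]; exact isUnit_one_add_two_mul_smul _ _)
    have hδδ : ρ (δ * δ) = ρ γ + (2 : ZMod (2 ^ m)) ^ (i + 1) • ((2 : ZMod (2 ^ m)) ^ (i - 3) • (Y * Y)) := by
      rw [hρ, hδ, one_add_smul_mul_self, hγ, smul_smul, ← pow_succ', ← pow_add, ← pow_add]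
      have e2 : i - 1 + 1 = i := by omega
      have e3 : i - 1 + (i - 1) = i + 1 + (i - 3) := by omega
      rw [e2, e3]
    have hQ : ∀ (η : Γ) (Z : Matrix (Fin 2) (Fin 2) (ZMod (2 ^ m))), ρ η = 1 + (2 : ZMod (2 ^ m)) ^ (i + 1) • Z → ψ η = 0 :=
      fun η Z hη ↦ ih (i + 1) (by omega) (by omega) η Z hη
    have hγ' : ρ γ = ρ (δ * δ) + (2 : ZMod (2 ^ m)) ^ (i + 1) • (-((2 : ZMod (2 ^ m)) ^ (i - 3) • (Y * Y))) := by
      rw [hδδ, smul_neg]; abel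
    rw [mcocycle_eq_of_congr hρ hρ1 hψ hQ _ hγ']
    rw [e1] at hδ
    exact mcocycle_sq_eq_zero hψ h2 hδ

end Filtration

/-! ### §6 Level `4`: trace-even elements via Cayley–Hamilton squares, then `Γ(4)` is killed (step (3)(b)) -/

section LevelFour

variable {ρ : Γ → Matrix (Fin 2) (Fin 2) (ZMod (2 ^ m))} {ψ : Γ → Fin 2 → ZMod (2 ^ m)}
variable (φ : ZMod (2 ^ m) →+* ZMod 2)

/-- A matrix of the shape `1 + (2c)•X` reduces to the identity modulo `2`. [folklore] -/
theorem map_eq_one_of_two_mul (hφ : ∀ x : ZMod (2 ^ m), φ x = 0 ↔ ∃ c : ZMod (2 ^ m), x = 2 * c)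
    {M X : Matrix (Fin 2) (Fin 2) (ZMod (2 ^ m))} {c : ZMod (2 ^ m)} (hM : M = 1 + (2 * c) • X) : M.map φ = 1 := by
  have h1 : (1 : Matrix (Fin 2) (Fin 2) (ZMod (2 ^ m))).map φ = 1 := Matrix.map_one _ (map_zero φ) (map_one φ)
  rw [← h1, map_eq_map_iff φ hφ]
  exact ⟨c • X, by rw [hM, mul_smul]⟩

/-- **Trace parity is preserved by a factor `≡ 1 (mod 2)`**: `tr(A M) ≡ tr A (mod 2)` when `M ≡ 1`. [folklore] -/
theorem map_trace_mul_of_map_eq_one {M : Matrix (Fin 2) (Fin 2) (ZMod (2 ^ m))} (hM : M.map φ = 1)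
    (A : Matrix (Fin 2) (Fin 2) (ZMod (2 ^ m))) : φ ((A * M) 0 0 + (A * M) 1 1) = φ (A 0 0 + A 1 1) := by
  have h00 : φ (M 0 0) = 1 := by simpa using congrFun (congrFun hM 0) 0
  have h01 : φ (M 0 1) = 0 := by simpa using congrFun (congrFun hM 0) 1
  have h10 : φ (M 1 0) = 0 := by simpa using congrFun (congrFun hM 1) 0
  have h11 : φ (M 1 1) = 1 := by simpa using congrFun (congrFun hM 1) 1
  simp only [Matrix.mul_apply, Fin.sum_univ_two, map_add, map_mul, h00, h01, h10, h11, mul_one, mul_zero, add_zero,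
    zero_add]

/-- Lifting an `𝔽₂`-matrix to `ℤ/2^m` (canonical representatives) and reducing gives it back. [folklore] -/
theorem map_lift_eq (hm : 1 ≤ m) (Ybar : Matrix (Fin 2) (Fin 2) (ZMod 2)) :
    (Ybar.map fun x : ZMod 2 ↦ ((x.val : ℕ) : ZMod (2 ^ m))).map
      (ZMod.castHom (dvd_pow_self 2 (by omega) : 2 ∣ 2 ^ m) (ZMod 2)) = Ybar := by
  ext i j
  simp only [map_apply, map_natCast, ZMod.natCast_zmod_val]

/-- **Trace-even elements of level `4` are killed** (given that level `8` is): if `ρ γ = 1 + 4•X` with `tr X` even then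
`γ ≡ (δδ)(δ'δ') (mod 8)` for `ρ δ = 1 + 2Y`, `ρ δ' = 1 + 2Y'` with `X ≡ (Y + Y²) + (Y' + Y'²) (mod 2)` (Cayley–Hamilton over `𝔽₂`:
the pen's `traceZero_sum_of_two_square_values`), and a `2`-torsion cocycle kills such squares. [cite: LawsonWuthrich2016, §7.1] -/
theorem vanishes_of_level_two_of_trace_even (hm : 1 ≤ m) (hρ : ∀ g h, ρ (g * h) = ρ g * ρ h) (hρ1 : ρ 1 = 1)
    (hsurj : ∀ M : Matrix (Fin 2) (Fin 2) (ZMod (2 ^ m)), IsUnit M → ∃ γ, ρ γ = M)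
    (hψ : ∀ g h, ψ (g * h) = ψ g + ρ g *ᵥ ψ h)
    (h2 : ∀ g, (2 : ZMod (2 ^ m)) • ψ g = 0)
    (Q3 : ∀ (η : Γ) (Z : Matrix (Fin 2) (Fin 2) (ZMod (2 ^ m))), ρ η = 1 + (2 : ZMod (2 ^ m)) ^ 3 • Z → ψ η = 0)
    {γ : Γ} {X : Matrix (Fin 2) (Fin 2) (ZMod (2 ^ m))} (hγ : ρ γ = 1 + (2 : ZMod (2 ^ m)) ^ 2 • X)
    (htr : ZMod.castHom (dvd_pow_self 2 (by omega) : 2 ∣ 2 ^ m) (ZMod 2) (X 0 0 + X 1 1) = 0) : ψ γ = 0 := by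
  set φ₂ : ZMod (2 ^ m) →+* ZMod 2 := ZMod.castHom (dvd_pow_self 2 (by omega) : 2 ∣ 2 ^ m) (ZMod 2) with hφ₂
  have hφ : ∀ x : ZMod (2 ^ m), φ₂ x = 0 ↔ ∃ c : ZMod (2 ^ m), x = 2 * c := castHom_two_eq_zero_iff hm
  -- the reduction of `X` has equal diagonal entries
  set Xb := X.map φ₂ with hXb
  have hdiag : Xb 1 1 = Xb 0 0 := by
    have h : φ₂ (X 0 0) + φ₂ (X 1 1) = 0 := by rw [← map_add]; exact htr
    have key : ∀ x y : ZMod 2, x + y = 0 → y = x := by decide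
    exact key _ _ h
  obtain ⟨e, f, g, h, e', f', g', h', hsq⟩ :=
    PhantomFinite.traceZero_sum_of_two_square_values (Xb 0 0) (Xb 0 1) (Xb 1 0)
  simp only [Prod.mk.injEq] at hsq
  obtain ⟨hq00, hq01, hq10, hq11⟩ := hsq
  -- lifts of the two square roots
  set Y : Matrix (Fin 2) (Fin 2) (ZMod (2 ^ m)) := (!![e, f; g, h]).map fun x : ZMod 2 ↦ ((x.val : ℕ) : ZMod (2 ^ m)) with hY
  set Y' : Matrix (Fin 2) (Fin 2) (ZMod (2 ^ m)) := (!![e', f'; g', h']).map fun x : ZMod 2 ↦ ((x.val : ℕ) : ZMod (2 ^ m))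
    with hY'
  have hYb : Y.map φ₂ = !![e, f; g, h] := map_lift_eq hm _
  have hY'b : Y'.map φ₂ = !![e', f'; g', h'] := map_lift_eq hm _
  have hq11' : Xb 1 1 = h + (g * f + h * h) + (h' + (g' * f' + h' * h')) := hdiag.trans hq11
  have hred : X.map φ₂ = ((Y + Y * Y) + (Y' + Y' * Y')).map φ₂ := by
    rw [Matrix.map_add _ (map_add φ₂), Matrix.map_add _ (map_add φ₂), Matrix.map_add _ (map_add φ₂), Matrix.map_mul,
      Matrix.map_mul, hYb, hY'b, ← hXb]
    ext i j; fin_cases i <;> fin_cases j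
    · simpa [Matrix.mul_apply, Fin.sum_univ_two] using hq00
    · simpa [Matrix.mul_apply, Fin.sum_univ_two] using hq01
    · simpa [Matrix.mul_apply, Fin.sum_univ_two] using hq10
    · simpa [Matrix.mul_apply, Fin.sum_univ_two] using hq11'
  obtain ⟨C, hC⟩ := (map_eq_map_iff φ₂ hφ _ _).mp hred
  -- realise the square roots
  obtain ⟨δ, hδ⟩ := hsurj (1 + (2 : ZMod (2 ^ m)) • Y) (isUnit_one_add_two_smul Y)
  obtain ⟨δ', hδ'⟩ := hsurj (1 + (2 : ZMod (2 ^ m)) • Y') (isUnit_one_add_two_smul Y')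
  have hδδ : ρ (δ * δ) = 1 + (2 : ZMod (2 ^ m)) ^ 2 • (Y + Y * Y) := by
    rw [hρ, hδ, one_add_smul_mul_self, pow_two, smul_add, add_assoc]
  have hδδ' : ρ (δ' * δ') = 1 + (2 : ZMod (2 ^ m)) ^ 2 • (Y' + Y' * Y') := by
    rw [hρ, hδ', one_add_smul_mul_self, pow_two, smul_add, add_assoc]
  have e1 : (2 : ZMod (2 ^ m)) ^ 2 * 2 ^ 2 = 2 ^ 3 * 2 := by ring
  have e2 : (2 : ZMod (2 ^ m)) ^ 2 * 2 = 2 ^ 3 := by ring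
  have hprod : ρ (δ * δ * (δ' * δ')) = 1 + (2 : ZMod (2 ^ m)) ^ 2 • ((Y + Y * Y) + (Y' + Y' * Y')) +
      (2 : ZMod (2 ^ m)) ^ 3 • ((2 : ZMod (2 ^ m)) • ((Y + Y * Y) * (Y' + Y' * Y'))) := by
    rw [hρ, hδδ, hδδ']
    simp only [add_mul, mul_add, one_mul, mul_one, smul_mul, Matrix.mul_smul, smul_smul, smul_add, e1]
    abel
  have hγ' : ρ γ = ρ (δ * δ * (δ' * δ')) +
      (2 : ZMod (2 ^ m)) ^ 3 • (C - (2 : ZMod (2 ^ m)) • ((Y + Y * Y) * (Y' + Y' * Y'))) := by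
    rw [hprod, hγ, hC]
    simp only [smul_add, smul_sub, smul_smul, e2]
    abel
  have hδ1 : ρ δ = 1 + (2 * 1 : ZMod (2 ^ m)) • Y := by rw [mul_one]; exact hδ
  have hδ'1 : ρ δ' = 1 + (2 * 1 : ZMod (2 ^ m)) • Y' := by rw [mul_one]; exact hδ'
  rw [mcocycle_eq_of_congr hρ hρ1 hψ Q3 _ hγ', hψ, mcocycle_sq_eq_zero hψ h2 hδ1, mcocycle_sq_eq_zero hψ h2 hδ'1,
    mulVec_zero, add_zero]

/-- **Trace-parity transport at level `4`**: if trace-even level-`4` elements are killed, then `ψ b = ψ a` whenever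
`ρ a = 1 + 4•A`, `ρ b = 1 + 4•B` with `tr A ≡ tr B (mod 2)`. [folklore] -/
theorem mcocycle_eq_of_trace (hρ : ∀ g h, ρ (g * h) = ρ g * ρ h)
    (hψ : ∀ g h, ψ (g * h) = ψ g + ρ g *ᵥ ψ h)
    (hφ : ∀ x : ZMod (2 ^ m), φ x = 0 ↔ ∃ c : ZMod (2 ^ m), x = 2 * c)
    (TE : ∀ (η : Γ) (X : Matrix (Fin 2) (Fin 2) (ZMod (2 ^ m))), ρ η = 1 + (2 : ZMod (2 ^ m)) ^ 2 • X →
      φ (X 0 0 + X 1 1) = 0 → ψ η = 0)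
    {a b : Γ} {A B : Matrix (Fin 2) (Fin 2) (ZMod (2 ^ m))} (ha : ρ a = 1 + (2 : ZMod (2 ^ m)) ^ 2 • A)
    (hb : ρ b = 1 + (2 : ZMod (2 ^ m)) ^ 2 • B) (htr : φ (A 0 0 + A 1 1) = φ (B 0 0 + B 1 1)) : ψ b = ψ a := by
  have hM := rho_inv_mul_eq hρ ha hb
  have hM1 : (ρ (a⁻¹ * b)).map φ = 1 :=
    map_eq_one_of_two_mul φ hφ (c := 2) (X := B - A * ρ (a⁻¹ * b)) (by rw [← pow_two]; exact hM)
  have hX' : φ ((B - A * ρ (a⁻¹ * b)) 0 0 + (B - A * ρ (a⁻¹ * b)) 1 1) = 0 := by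
    have h := map_trace_mul_of_map_eq_one φ hM1 A
    simp only [Matrix.sub_apply, map_add, map_sub] at h htr ⊢
    linear_combination -h - htr
  have : b = a * (a⁻¹ * b) := by group
  rw [this, hψ, TE _ _ hM hX', mulVec_zero, add_zero]

/-- `ρ s⁻¹ = S` and `ρ t⁻¹ = U⁻¹ = [[1,−1],[0,1]]`. [folklore] -/
theorem rho_inv_named (hρ : ∀ g h, ρ (g * h) = ρ g * ρ h) (hρ1 : ρ 1 = 1) {s t : Γ} (hs : ρ s = !![0, 1; 1, 0])
    (ht : ρ t = !![1, 1; 0, 1]) : ρ s⁻¹ = !![0, 1; 1, 0] ∧ ρ t⁻¹ = !![1, -1; 0, 1] := by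
  obtain ⟨-, -, -, hSS, -, -⟩ := named_products (m := m)
  have hUU' : (!![1, 1; 0, 1] : Matrix (Fin 2) (Fin 2) (ZMod (2 ^ m))) * !![1, -1; 0, 1] = 1 := by
    ext i j; fin_cases i <;> fin_cases j <;> simp [Matrix.mul_apply, Fin.sum_univ_two]
  constructor
  · calc ρ s⁻¹ = ρ s⁻¹ * (ρ s * !![0, 1; 1, 0]) := by rw [hs, hSS, mul_one]
      _ = !![0, 1; 1, 0] := by rw [← mul_assoc, rho_inv_mul hρ hρ1, one_mul]
  · calc ρ t⁻¹ = ρ t⁻¹ * (ρ t * !![1, -1; 0, 1]) := by rw [ht, hUU', mul_one]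
      _ = !![1, -1; 0, 1] := by rw [← mul_assoc, rho_inv_mul hρ hρ1, one_mul]

/-- A `2`-torsion vector fixed by `S` and `U` is zero. [folklore] -/
theorem eq_zero_of_fixed (v : Fin 2 → ZMod (2 ^ m)) (hS : !![0, 1; 1, 0] *ᵥ v = v) (hU : !![1, 1; 0, 1] *ᵥ v = v) :
    v = 0 := by
  rw [mulVec_fin_two] at hS hU
  have h0 := congrFun hS 0
  have h1 := congrFun hU 0
  simp only [of_apply, cons_val', cons_val_zero, cons_val_one, cons_val_fin_one, empty_val', zero_mul, one_mul,
    zero_add] at h0 h1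
  ext i; fin_cases i
  · simp only [Pi.zero_apply, Fin.zero_eta, Fin.isValue]; linear_combination h1 - h0
  · simp only [Pi.zero_apply, Fin.mk_one, Fin.isValue]; linear_combination h1

/-- **Step (3)(b): `Γ(4)` is killed.** For a normalised cocycle (2-torsion values, vanishing on `ker ρ`) of a group mapping ONTO the
units: `ψ γ = 0` whenever `ρ γ = 1 + 4•X`. (Reduce to `θ_k`, `ρ θ_k = 1 + 4k E₁₁`, by trace parity; then `ψ θ_k` is fixed by `S` and `U`,
comparing `s θ s⁻¹`, `t θ t⁻¹` with `θ` by trace parity, hence zero.) [cite: LawsonWuthrich2016, §7.1] -/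
theorem vanishes_of_level_two (hm : 1 ≤ m) (hρ : ∀ g h, ρ (g * h) = ρ g * ρ h) (hρ1 : ρ 1 = 1)
    (hsurj : ∀ M : Matrix (Fin 2) (Fin 2) (ZMod (2 ^ m)), IsUnit M → ∃ γ, ρ γ = M)
    (hψ : ∀ g h, ψ (g * h) = ψ g + ρ g *ᵥ ψ h) (hN : ∀ n, ρ n = 1 → ψ n = 0)
    (h2 : ∀ g, (2 : ZMod (2 ^ m)) • ψ g = 0) {s t : Γ} (hs : ρ s = !![0, 1; 1, 0]) (ht : ρ t = !![1, 1; 0, 1])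
    {γ : Γ} {X : Matrix (Fin 2) (Fin 2) (ZMod (2 ^ m))} (hγ : ρ γ = 1 + (2 : ZMod (2 ^ m)) ^ 2 • X) : ψ γ = 0 := by
  set φ₂ : ZMod (2 ^ m) →+* ZMod 2 := ZMod.castHom (dvd_pow_self 2 (by omega) : 2 ∣ 2 ^ m) (ZMod 2) with hφ₂
  have hφ : ∀ x : ZMod (2 ^ m), φ₂ x = 0 ↔ ∃ c : ZMod (2 ^ m), x = 2 * c := castHom_two_eq_zero_iff hm
  have Q3 := vanishes_of_level_ge_three hρ hρ1 hsurj hψ hN h2 3 le_rfl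
  have TE : ∀ (η : Γ) (X : Matrix (Fin 2) (Fin 2) (ZMod (2 ^ m))), ρ η = 1 + (2 : ZMod (2 ^ m)) ^ 2 • X →
      φ₂ (X 0 0 + X 1 1) = 0 → ψ η = 0 :=
    fun η X hη hX ↦ vanishes_of_level_two_of_trace_even hm hρ hρ1 hsurj hψ h2 Q3 hη hX
  -- the elementary element `θ` with `ρ θ = 1 + 4k E₁₁`, `k = tr X`
  set k : ZMod (2 ^ m) := X 0 0 + X 1 1 with hk
  obtain ⟨θ, hθ⟩ := hsurj (1 + (2 : ZMod (2 ^ m)) ^ 2 • (k • !![1, 0; 0, 0]))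
    (by rw [pow_two, smul_smul, mul_assoc, mul_smul]; exact isUnit_one_add_two_smul _)
  have htrθ : φ₂ ((k • !![1, 0; 0, 0] : Matrix (Fin 2) (Fin 2) (ZMod (2 ^ m))) 0 0 +
      (k • !![1, 0; 0, 0] : Matrix (Fin 2) (Fin 2) (ZMod (2 ^ m))) 1 1) = φ₂ (X 0 0 + X 1 1) := by
    congr 1; simp [hk]
  -- `ψ γ = ψ θ`
  rw [mcocycle_eq_of_trace φ₂ hρ hψ hφ TE hθ hγ htrθ]
  -- `ψ θ` is fixed by `S` and by `U`
  obtain ⟨hsi, hti⟩ := rho_inv_named hρ hρ1 hs ht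
  have hfixθ : ∀ g : Γ, ρ θ *ᵥ ψ g⁻¹ = ψ g⁻¹ := fun g ↦
    mulVec_eq_self_of_mod_two (A := (2 * k) • !![1, 0; 0, 0])
      (by rw [hθ, pow_two, smul_smul, mul_assoc, mul_smul]) (h2 _)
  have hS : !![0, 1; 1, 0] *ᵥ ψ θ = ψ θ := by
    have hconj : ρ (s * θ * s⁻¹) = 1 + (2 : ZMod (2 ^ m)) ^ 2 • (k • !![0, 0; 0, 1]) := by
      rw [hρ, hρ, hs, hθ, hsi, one_fin_two]
      ext i j; fin_cases i <;> fin_cases j <;> simp [Matrix.mul_apply, Fin.sum_univ_two]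
    have htr : φ₂ ((k • !![1, 0; 0, 0] : Matrix (Fin 2) (Fin 2) (ZMod (2 ^ m))) 0 0 +
        (k • !![1, 0; 0, 0] : Matrix (Fin 2) (Fin 2) (ZMod (2 ^ m))) 1 1) =
        φ₂ ((k • !![0, 0; 0, 1] : Matrix (Fin 2) (Fin 2) (ZMod (2 ^ m))) 0 0 +
        (k • !![0, 0; 0, 1] : Matrix (Fin 2) (Fin 2) (ZMod (2 ^ m))) 1 1) := by
      congr 1; simp
    rw [← hs, ← mcocycle_conj hψ hρ1 hρ s θ (hfixθ s)]
    exact mcocycle_eq_of_trace φ₂ hρ hψ hφ TE hθ hconj htr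
  have hU : !![1, 1; 0, 1] *ᵥ ψ θ = ψ θ := by
    have hconj : ρ (t * θ * t⁻¹) = 1 + (2 : ZMod (2 ^ m)) ^ 2 • (k • !![1, -1; 0, 0]) := by
      rw [hρ, hρ, ht, hθ, hti, one_fin_two]
      ext i j; fin_cases i <;> fin_cases j <;> simp [Matrix.mul_apply, Fin.sum_univ_two]
    have htr : φ₂ ((k • !![1, 0; 0, 0] : Matrix (Fin 2) (Fin 2) (ZMod (2 ^ m))) 0 0 +
        (k • !![1, 0; 0, 0] : Matrix (Fin 2) (Fin 2) (ZMod (2 ^ m))) 1 1) =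
        φ₂ ((k • !![1, -1; 0, 0] : Matrix (Fin 2) (Fin 2) (ZMod (2 ^ m))) 0 0 +
        (k • !![1, -1; 0, 0] : Matrix (Fin 2) (Fin 2) (ZMod (2 ^ m))) 1 1) := by
      congr 1
    rw [← ht, ← mcocycle_conj hψ hρ1 hρ t θ (hfixθ t)]
    exact mcocycle_eq_of_trace φ₂ hρ hψ hφ TE hθ hconj htr
  exact eq_zero_of_fixed _ hS hU

end LevelFour

end Summit.BirchSwinnertonDyer.BirchSwinnertonDyer.Theorems.KolyvaginAtTwo.PhantomMatrix
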